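import Mathlib
import Summits.ResolutionOfSingularities.ResolutionOfSingularities.Theorems.HomologicalConductorSurfaceTerminationCubicConeWitness
import Literature.RingTheory.KrullDimension.AffineCatenary
import HarnessLib

/-!
# Kill test `SurfaceTermination` (stmt-ResolutionOfSingularities-16488), (R-QH) «CUBIC CONE EXIT», part 4:
# the witness has Krull dimension `2`, and the EXIT itself is inhabited

Route `ResolutionOfSingularities/HomologicalConductor` (cell `res-hironaka`, chain W4.4), kill test `SurfaceTermination`
(stmt-16488), residue stub `stub_initialPairOfConstantGenus`; res-L0-w44-plan-1 CHAIN v23 «GO … + the witness valuation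
(non-vacuity)», res-D-pv-045 g7. OURS; AI-written, weaker than expert review; nothing here is a statement of the manuscript
under review (Hironaka 2017) and no statement of it is used; no theorem here concludes the kill test or the crux.

Part 3 (`…CubicConeWitness`) inhabits the hypotheses `hker, hk, hx, hW, IsFractionRing` of parts 1–2 over every field `k`
(`K = Frac (k[X] ⧸ (f))`, `O` = the weight valuation ring). The exit theorem `exists_isRegularLocalRing_tower_cubicCone`
carries two more of the kill test's binders: `CharP k p` and `ringKrullDim ↥A = 2`. Here:
* `ringKrullDim_range_eq_two` — `dim k[x,y,z] = 2` for the cubic cone inside `K = Frac (k[X] ⧸ (f))` (the tree's hypersurface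
  dimension formula `Literature.RingTheory.KrullDimension.ringKrullDim_quotient_span_of_prime_mvPolynomial` at the prime `f`,
  part 3's `prime_f`, transported along `k[X] ⧸ (f) ≃ range`);
* **`exists_cubicCone_witness_full`** — for every field `k`: `K, x, y, z, O` with `hker ∧ hk ∧ hx ∧ hW ∧ IsFractionRing ∧ dim = 2`;
* **`exists_isRegularLocalRing_tower_cubicCone_inhabited`** — for every prime `p` and every field `k` of characteristic `p`
  there is a datum `(K, A = k[x,y,z], O)` of the kill test — the cubic cone (a NON-RATIONAL surface germ, `p_g = 1` for
  `p ≠ 3`) with its weight valuation — AT WHICH `SurfaceTermination`'s conclusion `∃ m, IsRegularLocalRing ↥(tower O A m)` is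
  kernel-certified: the first non-rational instance of the kill test in the tree.
References (mechanism only): [cite: Matsumura1987, Thm 5.6] (dimension of a hypersurface, via the tree).
-/

noncomputable section

-- single-problem summit: the doubled namespace component `ResolutionOfSingularities` is forced
set_option linter.dupNamespace false

namespace Summit.ResolutionOfSingularities.ResolutionOfSingularities.Theorems.SurfaceTermination.CubicCone

open MvPolynomial
open Summit.ResolutionOfSingularities.ResolutionOfSingularities.Theorems.NoZeno.Birth

section Dim

variable {k K : Type} [Field k] [Field K] [Algebra k K]
  [Algebra (MvPolynomial (Fin 3) k ⧸ Ideal.span ({X 0 ^ 2 * X 1 + X 1 ^ 2 * X 2 + X 2 ^ 2 * X 0} :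
    Set (MvPolynomial (Fin 3) k))) K]
  [IsScalarTower k (MvPolynomial (Fin 3) k ⧸ Ideal.span ({X 0 ^ 2 * X 1 + X 1 ^ 2 * X 2 + X 2 ^ 2 * X 0} :
    Set (MvPolynomial (Fin 3) k))) K]
  [IsFractionRing (MvPolynomial (Fin 3) k ⧸ Ideal.span ({X 0 ^ 2 * X 1 + X 1 ^ 2 * X 2 + X 2 ^ 2 * X 0} :
    Set (MvPolynomial (Fin 3) k))) K]

/-- **`dim k[x,y,z] = 2`** for the cubic cone inside its fraction field: the range of `Xᵢ ↦ x, y, z` is isomorphic to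
`k[X] ⧸ (f)`, a hypersurface in affine `3`-space cut out by the prime `f`. [cite: Matsumura1987, Thm 5.6] -/
theorem ringKrullDim_range_eq_two :
    ringKrullDim ↥(MvPolynomial.aeval (R := k)
      (![algebraMap _ K (Ideal.Quotient.mk (Ideal.span ({X 0 ^ 2 * X 1 + X 1 ^ 2 * X 2 + X 2 ^ 2 * X 0} :
          Set (MvPolynomial (Fin 3) k))) (X 0)),
        algebraMap _ K (Ideal.Quotient.mk (Ideal.span ({X 0 ^ 2 * X 1 + X 1 ^ 2 * X 2 + X 2 ^ 2 * X 0} :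
          Set (MvPolynomial (Fin 3) k))) (X 1)),
        algebraMap _ K (Ideal.Quotient.mk (Ideal.span ({X 0 ^ 2 * X 1 + X 1 ^ 2 * X 2 + X 2 ^ 2 * X 0} :
          Set (MvPolynomial (Fin 3) k))) (X 2))] : Fin 3 → K)).range = 2 := by
  set A := MvPolynomial (Fin 3) k ⧸ Ideal.span ({X 0 ^ 2 * X 1 + X 1 ^ 2 * X 2 + X 2 ^ 2 * X 0} :
    Set (MvPolynomial (Fin 3) k)) with hA
  let ιA : A →ₐ[k] K := IsScalarTower.toAlgHom k A K
  have hι : Function.Injective ιA := IsFractionRing.injective A K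
  have hgι : (![algebraMap A K (Ideal.Quotient.mk _ (X 0)), algebraMap A K (Ideal.Quotient.mk _ (X 1)),
      algebraMap A K (Ideal.Quotient.mk _ (X 2))] : Fin 3 → K) =
      ![ιA (Ideal.Quotient.mk _ (X 0)), ιA (Ideal.Quotient.mk _ (X 1)), ιA (Ideal.Quotient.mk _ (X 2))] := rfl
  have hrange : (MvPolynomial.aeval (R := k) (![algebraMap A K (Ideal.Quotient.mk _ (X 0)),
      algebraMap A K (Ideal.Quotient.mk _ (X 1)), algebraMap A K (Ideal.Quotient.mk _ (X 2))] : Fin 3 → K)).range =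
      ιA.range := by
    rw [hgι, aeval_eq_comp_mk ιA, AlgHom.range_comp, (AlgHom.range_eq_top _).mpr (Ideal.Quotient.mkₐ_surjective k _),
      Algebra.map_top]
  have e : A ≃+* ↥(MvPolynomial.aeval (R := k) (![algebraMap A K (Ideal.Quotient.mk _ (X 0)),
      algebraMap A K (Ideal.Quotient.mk _ (X 1)), algebraMap A K (Ideal.Quotient.mk _ (X 2))] : Fin 3 → K)).range :=
    ((AlgEquiv.ofInjective ιA hι).trans (Subalgebra.equivOfEq _ _ hrange.symm)).toRingEquiv
  rw [← ringKrullDim_eq_of_ringEquiv e]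
  have h := Literature.RingTheory.KrullDimension.ringKrullDim_quotient_span_of_prime_mvPolynomial (prime_f k)
  exact h.trans (by norm_num)

end Dim

/-- **THE FULL WITNESS (OURS · W4.4 (R-QH)).** For every field `k`: a field `K ⊇ k`, `x, y, z ∈ K` and a valuation ring
`O ⊆ K` with `hker` (the kernel of `Xᵢ ↦ x, y, z` is `(f)`), `k ⊆ O`, `O.valuation x < 1`, the WEIGHT property,
`IsFractionRing ↥k[x,y,z] K` and `ringKrullDim ↥k[x,y,z] = 2` — every datum hypothesis of parts 1–2. [OURS · W4.4 kill test] -/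
theorem exists_cubicCone_witness_full (k : Type) [Field k] :
    ∃ (K : Type) (_ : Field K) (_ : Algebra k K) (x y z : K) (O : ValuationSubring K),
      RingHom.ker (MvPolynomial.aeval (R := k) (![x, y, z] : Fin 3 → K)).toRingHom =
          Ideal.span {X 0 ^ 2 * X 1 + X 1 ^ 2 * X 2 + X 2 ^ 2 * X 0} ∧
        (∀ c : k, algebraMap k K c ∈ O) ∧ O.valuation x < 1 ∧
        (∀ (d : ℕ) (F : MvPolynomial (Fin 3) k), F.IsHomogeneous d → MvPolynomial.aeval ![x, y, z] F ≠ 0 →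
          O.valuation (MvPolynomial.aeval ![x, y, z] F) = O.valuation x ^ d) ∧
        IsFractionRing ↥(MvPolynomial.aeval (R := k) (![x, y, z] : Fin 3 → K)).range K ∧
        ringKrullDim ↥(MvPolynomial.aeval (R := k) (![x, y, z] : Fin 3 → K)).range = 2 := by
  letI := isDomain_quotient_f k
  set A := MvPolynomial (Fin 3) k ⧸ Ideal.span ({X 0 ^ 2 * X 1 + X 1 ^ 2 * X 2 + X 2 ^ 2 * X 0} :
    Set (MvPolynomial (Fin 3) k)) with hA
  obtain ⟨O, hk, hx, hW⟩ := exists_weightValuation (k := k) (K := FractionRing A)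
  refine ⟨FractionRing A, inferInstance, inferInstance,
    algebraMap A (FractionRing A) (Ideal.Quotient.mk (Ideal.span ({X 0 ^ 2 * X 1 + X 1 ^ 2 * X 2 + X 2 ^ 2 * X 0} :
      Set (MvPolynomial (Fin 3) k))) (X 0)),
    algebraMap A (FractionRing A) (Ideal.Quotient.mk (Ideal.span ({X 0 ^ 2 * X 1 + X 1 ^ 2 * X 2 + X 2 ^ 2 * X 0} :
      Set (MvPolynomial (Fin 3) k))) (X 1)),
    algebraMap A (FractionRing A) (Ideal.Quotient.mk (Ideal.span ({X 0 ^ 2 * X 1 + X 1 ^ 2 * X 2 + X 2 ^ 2 * X 0} :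
      Set (MvPolynomial (Fin 3) k))) (X 2)), O, ?_, hk, hx, hW, isFractionRing_range, ringKrullDim_range_eq_two⟩
  exact ker_aeval_eq_span_f (IsScalarTower.toAlgHom k A (FractionRing A)) (IsFractionRing.injective A _)

/-- **THE EXIT IS INHABITED (OURS · W4.4 (R-QH)).** For every prime `p` and every field `k` of characteristic `p` there is a
datum of the kill test `SurfaceTermination` — `A = k[x,y,z]` the cubic cone `x²y + y²z + z²x = 0` (a NON-RATIONAL normal
surface germ for `p ≠ 3`: simple-elliptic `Ẽ₆`, `p_g = 1`) inside its fraction field `K`, `O` its weight valuation ring,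
`k ⊆ O`, `A ⊆ O`, `A` finitely generated of dimension `2`, `Frac A = K` — AT WHICH the kill test's conclusion holds by the
kernel: **`∃ m, IsRegularLocalRing ↥(tower O A m)`** (part 2's `exists_isRegularLocalRing_tower_cubicCone` at part 3's
witness). [OURS · W4.4 kill test] -/
theorem exists_isRegularLocalRing_tower_cubicCone_inhabited (p : ℕ) (hp : p.Prime) (k : Type) [Field k] [CharP k p] :
    ∃ (K : Type) (_ : Field K) (_ : Algebra k K) (x y z : K) (O : ValuationSubring K),
      RingHom.ker (MvPolynomial.aeval (R := k) (![x, y, z] : Fin 3 → K)).toRingHom =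
          Ideal.span {X 0 ^ 2 * X 1 + X 1 ^ 2 * X 2 + X 2 ^ 2 * X 0} ∧
        (∀ c : k, algebraMap k K c ∈ O) ∧
        (MvPolynomial.aeval (R := k) (![x, y, z] : Fin 3 → K)).range.FG ∧
        IsFractionRing ↥(MvPolynomial.aeval (R := k) (![x, y, z] : Fin 3 → K)).range K ∧
        (MvPolynomial.aeval (R := k) (![x, y, z] : Fin 3 → K)).range.toSubring ≤ O.toSubring ∧
        ringKrullDim ↥(MvPolynomial.aeval (R := k) (![x, y, z] : Fin 3 → K)).range = 2 ∧
        ∃ m : ℕ, IsRegularLocalRing ↥(tower O (MvPolynomial.aeval (R := k) (![x, y, z] : Fin 3 → K)).range m) := by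
  obtain ⟨K, _, _, x, y, z, O, hker, hk, hx, hW, hfr, hdim⟩ := exists_cubicCone_witness_full k
  have hA : (MvPolynomial.aeval (R := k) (![x, y, z] : Fin 3 → K)).range.FG :=
    ⟨(Set.finite_range ![x, y, z]).toFinset, by rw [Set.Finite.coe_toFinset, Algebra.adjoin_range_eq_range_aeval]⟩
  have hAO : (MvPolynomial.aeval (R := k) (![x, y, z] : Fin 3 → K)).range.toSubring ≤ O.toSubring := by
    rintro a ⟨q, rfl⟩
    exact HomologicalConductor.KC3Upper.aeval_mem_valuationSubring _ O hk (valuation_coord_lt_one hker hW hx) q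
  exact ⟨K, inferInstance, inferInstance, x, y, z, O, hker, hk, hA, hfr, hAO, hdim,
    exists_isRegularLocalRing_tower_cubicCone hker hW hx hk p hp hfr hdim⟩

end Summit.ResolutionOfSingularities.ResolutionOfSingularities.Theorems.SurfaceTermination.CubicCone

end
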